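import Literature.Barriers.MatrixMultiplication.IrreversibilityBarrierGaugeBounds
import HarnessLib

/-!
# The big centroid family `T_{p,q,r}` (Kassabov–Landsberg–Souza–Speegle 2026), I: flattening rank and cross-entropy certificate

Solo programme `solo-MatrixMultiplication-informed` (gen 58), claim c463, part 1 of 2 (part 2:
`SoloInformedBigCentroidFamilyBarrier`). The whole three-parameter family of big centroid tensors
of arXiv:2608.27434 is placed, in the kernel and uniformly in `(p,q,r)`, against constraint C2 of
the programme's sharpest statement — the Christandl–Vrana–Zuiddam irreversibility barrier
(`IrreversibilityBarrier_holds`); the earlier files treat the balanced members `T_{n,n,n}`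
(`SoloInformedBigCentroidBarrier`) and the corners `T_{1,1,r}` (`SoloInformedBigCentroidCorners`).

The **big centroid tensor** (KLSS Ex. 2.2; `i < p`, `j < q`, `k < r`)
`T_{p,q,r} = Σ_{j,k} a_{jk} b_j c_k + Σ_{i,k} a_i b_{ik} c_k + Σ_{i,j} a_i b_j c_{ij}
 ∈ K^{qr+p} ⊗ K^{pr+q} ⊗ K^{pq+r}` is the nearly disjoint sum of `⟨1,q,r⟩`, `⟨p,1,r⟩`, `⟨p,q,1⟩`;
KLSS prove minimal border rank for `T_{n,n,n}` (Thm. 2.7) and `T_{p,q,1}` (Thm. 2.8) and ask it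
in general (Question 2.9).

**This file** (any field `K`; `p, q, r ≥ 1`):
* `bigcen K p q r` on the index types `IdxA = (Fin q × Fin r) ⊕ Fin p`,
  `IdxB = (Fin p × Fin r) ⊕ Fin q`, `IdxC = (Fin p × Fin q) ⊕ Fin r`;
* `flatteningRank_bigcen` — `ζ⁽¹⁾(T_{p,q,r}) = qr + p` (the `A`-flattening is injective), whence
  `ω(⟨2⟩, T_{p,q,r}) ≥ log₂(qr + p)`; this is the largest of the three flattening ranks exactly
  when `p = min(p,q,r)` (`(qr+p) − (pr+q) = (q−p)(r−1)`), which one may assume after permuting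
  the roles of `a, b, c`;
* the **one-parameter cross-entropy certificate** `famWA/B/C d` (`d > 0`):
  `a_{jk} ↦ d/((p²+d)qr)`, `a_i ↦ p/(p²+d)`; `b_{ik} ↦ d/((q²+d)pr)`, `b_j ↦ q/(q²+d)`;
  `c_{ij} ↦ d/((r²+d)pq)`, `c_k ↦ r/(r²+d)` — probability vectors whose product equals
  `θ_d³ := d/((p²+d)(q²+d)(r²+d))` at EVERY support point (`famWeight_supp`), so that
  `Q̃(T_{p,q,r}) ≤ E_d^{1/3}` with `E_d := (p²+d)(q²+d)(r²+d)/d`, for every `d > 0`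
  (`three_div_le_relativeExponent_bigcen_unit`; the best `d` solves `1/d = Σ 1/(p_i²+d)`;
  `d = n²/2` is the certificate of `SoloInformedBigCentroidBarrier`, `d = 1` that of
  `SoloInformedBigCentroidCorners`).
Part 2 combines the two sides through CVZ Thm. 9 and shows that the barrier value exceeds `2`
for every shape other than the W-state `(1,1,1)`.

References: [cite: KassabovEtAl2026, Ex. 2.2, Thm. 2.7, Thm. 2.8, Q. 2.9] (arXiv:2608.27434);
[cite: ChristandlVranaZuiddam2021, Prop. 17, §4.2].
-/

open scoped BigOperators

namespace Summit.MatrixMultiplication.MatrixMultiplication.Theorems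

open Literature.Computability.AlgebraicComplexity Literature.Barriers.MatrixMultiplication

namespace BigCentroidFamily

/-! ## The tensor -/

/-- Index type of the `A`-factor: matrix coordinates `a_{jk}` and vector coordinates `a_i`.
[cite: KassabovEtAl2026, Ex. 2.2] -/
abbrev IdxA (p q r : ℕ) : Type := (Fin q × Fin r) ⊕ Fin p

/-- Index type of the `B`-factor: matrix coordinates `b_{ik}` and vector coordinates `b_j`.
[cite: KassabovEtAl2026, Ex. 2.2] -/
abbrev IdxB (p q r : ℕ) : Type := (Fin p × Fin r) ⊕ Fin q

/-- Index type of the `C`-factor: matrix coordinates `c_{ij}` and vector coordinates `c_k`.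
[cite: KassabovEtAl2026, Ex. 2.2] -/
abbrev IdxC (p q r : ℕ) : Type := (Fin p × Fin q) ⊕ Fin r

/-- `|IdxA| = qr + p`. [folklore] -/
theorem card_idxA (p q r : ℕ) : Fintype.card (IdxA p q r) = q * r + p := by
  simp [Fintype.card_sum, Fintype.card_prod, Fintype.card_fin]

variable (K : Type) [Field K]

/-- The **big centroid tensor** `T_{p,q,r}
= Σ_{j,k} a_{jk} b_j c_k + Σ_{i,k} a_i b_{ik} c_k + Σ_{i,j} a_i b_j c_{ij}`.
[cite: KassabovEtAl2026, Ex. 2.2] -/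
def bigcen (p q r : ℕ) : IdxA p q r → IdxB p q r → IdxC p q r → K
  | Sum.inl jk, Sum.inr j, Sum.inr k => if jk = (j, k) then 1 else 0
  | Sum.inr i, Sum.inl ik, Sum.inr k => if ik = (i, k) then 1 else 0
  | Sum.inr i, Sum.inr j, Sum.inl ij => if ij = (i, j) then 1 else 0
  | Sum.inl _, Sum.inl _, _ => 0
  | Sum.inl _, Sum.inr _, Sum.inl _ => 0
  | Sum.inr _, Sum.inl _, Sum.inl _ => 0
  | Sum.inr _, Sum.inr _, Sum.inr _ => 0

variable {K} {p q r : ℕ}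

/-- Entry `(a_{jk}, b_{j'}, c_{k'})`. [cite: KassabovEtAl2026, Ex. 2.2] -/
@[simp] theorem bigcen_lrr (jk : Fin q × Fin r) (j : Fin q) (k : Fin r) :
    bigcen K p q r (Sum.inl jk) (Sum.inr j) (Sum.inr k) = if jk = (j, k) then 1 else 0 := rfl

/-- Entry `(a_i, b_{i'k}, c_{k'})`. [cite: KassabovEtAl2026, Ex. 2.2] -/
@[simp] theorem bigcen_rlr (i : Fin p) (ik : Fin p × Fin r) (k : Fin r) :
    bigcen K p q r (Sum.inr i) (Sum.inl ik) (Sum.inr k) = if ik = (i, k) then 1 else 0 := rfl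

/-- Entry `(a_i, b_j, c_{i'j'})`. [cite: KassabovEtAl2026, Ex. 2.2] -/
@[simp] theorem bigcen_rrl (i : Fin p) (j : Fin q) (ij : Fin p × Fin q) :
    bigcen K p q r (Sum.inr i) (Sum.inr j) (Sum.inl ij) = if ij = (i, j) then 1 else 0 := rfl

/-- Two matrix coordinates in `A` and `B`: zero. [cite: KassabovEtAl2026, Ex. 2.2] -/
@[simp] theorem bigcen_ll (jk : Fin q × Fin r) (ik : Fin p × Fin r) (c : IdxC p q r) :
    bigcen K p q r (Sum.inl jk) (Sum.inl ik) c = 0 := by cases c <;> rfl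

/-- Matrix coordinates in `A` and `C`: zero. [cite: KassabovEtAl2026, Ex. 2.2] -/
@[simp] theorem bigcen_lrl (jk : Fin q × Fin r) (j : Fin q) (ij : Fin p × Fin q) :
    bigcen K p q r (Sum.inl jk) (Sum.inr j) (Sum.inl ij) = 0 := rfl

/-- Matrix coordinates in `B` and `C`: zero. [cite: KassabovEtAl2026, Ex. 2.2] -/
@[simp] theorem bigcen_rll (i : Fin p) (ik : Fin p × Fin r) (ij : Fin p × Fin q) :
    bigcen K p q r (Sum.inr i) (Sum.inl ik) (Sum.inl ij) = 0 := rfl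

/-- Three vector coordinates: zero. [cite: KassabovEtAl2026, Ex. 2.2] -/
@[simp] theorem bigcen_rrr (i : Fin p) (j : Fin q) (k : Fin r) :
    bigcen K p q r (Sum.inr i) (Sum.inr j) (Sum.inr k) = 0 := rfl

/-! ## `R̃`-side: the `A`-flattening of `T_{p,q,r}` is injective -/

/-- The `x`-slices of `T_{p,q,r}` are linearly independent (`r ≥ 1`): the slice of `a_{jk}` owns
the coordinate `(b_j, c_k)`, the slice of `a_i` owns `(b_{i0}, c_0)`. [cite: KassabovEtAl2026, Ex. 2.2] -/
theorem linearIndependent_xSlices_bigcen (hr : 1 ≤ r) :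
    LinearIndependent K (xSlices (bigcen K p q r)) := by
  rw [Fintype.linearIndependent_iff]
  intro g hg
  have ev : ∀ (b : IdxB p q r) (c : IdxC p q r), ∑ a, g a * bigcen K p q r a b c = 0 := fun b c => by
    have h := congr_fun hg (b, c)
    simpa [Finset.sum_apply, Pi.smul_apply, smul_eq_mul] using h
  rintro (⟨j, k⟩ | i)
  · have h := ev (Sum.inr j) (Sum.inr k)
    rw [Finset.sum_eq_single (Sum.inl (j, k) : IdxA p q r) (fun b _ hb => ?_) (by simp)] at h
    · simpa using h
    · rcases b with jk | i
      · have hjk : jk ≠ (j, k) := fun e => hb (by rw [e])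
        simp [hjk]
      · simp
  · have k₀ : Fin r := ⟨0, hr⟩
    have h := ev (Sum.inl (i, k₀)) (Sum.inr k₀)
    rw [Finset.sum_eq_single (Sum.inr i : IdxA p q r) (fun b _ hb => ?_) (by simp)] at h
    · simpa using h
    · rcases b with jk | i'
      · simp
      · have hi : (i, k₀) ≠ (i', k₀) := fun e => hb (by rw [(Prod.mk.inj e).1])
        simp [hi]

/-- **`ζ⁽¹⁾(T_{p,q,r}) = qr + p`** (`r ≥ 1`; the `A`-flattening is injective).
[cite: KassabovEtAl2026, Ex. 2.2] -/
theorem flatteningRank_bigcen (hr : 1 ≤ r) : flatteningRank (bigcen K p q r) = q * r + p := by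
  rw [flatteningRank, finrank_span_eq_card (linearIndependent_xSlices_bigcen hr), card_idxA]

/-- **`ω(⟨2⟩, T_{p,q,r}) ≥ log₂(qr + p)`** (`r ≥ 1`; CVZ Prop. 17: `R̃ ≥` flattening rank).
[cite: ChristandlVranaZuiddam2021, Prop. 17] -/
theorem logb_le_relativeExponent_unit_bigcen (hr : 1 ≤ r) :
    Real.logb 2 ((q : ℝ) * r + p) ≤ relativeExponent (unitTensor K 2) (bigcen K p q r) := by
  have h := logb_flatteningRank_le_relativeExponent (K := K) (bigcen K p q r)
  rw [flatteningRank_bigcen hr] at h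
  push_cast at h
  exact h

/-! ## `Q̃`-side: the one-parameter cross-entropy certificate -/

/-- `E_d = (p²+d)(q²+d)(r²+d)/d`, the certified upper bound for `Q̃(T_{p,q,r})³`.
[cite: ChristandlVranaZuiddam2021, §4.2] -/
noncomputable def famE (p q r : ℕ) (d : ℝ) : ℝ :=
  ((p : ℝ) ^ 2 + d) * ((q : ℝ) ^ 2 + d) * ((r : ℝ) ^ 2 + d) / d

/-- Weights on `A`: `a_{jk} ↦ d/((p²+d)qr)`, `a_i ↦ p/(p²+d)`. [cite: ChristandlVranaZuiddam2021, §4.2] -/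
noncomputable def famWA (p q r : ℕ) (d : ℝ) : IdxA p q r → ℝ :=
  Sum.elim (fun _ => d / (((p : ℝ) ^ 2 + d) * (q * r))) (fun _ => (p : ℝ) / ((p : ℝ) ^ 2 + d))

/-- Weights on `B`: `b_{ik} ↦ d/((q²+d)pr)`, `b_j ↦ q/(q²+d)`. [cite: ChristandlVranaZuiddam2021, §4.2] -/
noncomputable def famWB (p q r : ℕ) (d : ℝ) : IdxB p q r → ℝ :=
  Sum.elim (fun _ => d / (((q : ℝ) ^ 2 + d) * (p * r))) (fun _ => (q : ℝ) / ((q : ℝ) ^ 2 + d))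

/-- Weights on `C`: `c_{ij} ↦ d/((r²+d)pq)`, `c_k ↦ r/(r²+d)`. [cite: ChristandlVranaZuiddam2021, §4.2] -/
noncomputable def famWC (p q r : ℕ) (d : ℝ) : IdxC p q r → ℝ :=
  Sum.elim (fun _ => d / (((r : ℝ) ^ 2 + d) * (p * q))) (fun _ => (r : ℝ) / ((r : ℝ) ^ 2 + d))

variable {d : ℝ}

/-- The `A`-weights are nonnegative (`d ≥ 0`). [folklore] -/
theorem famWA_nonneg (hd : 0 ≤ d) (a : IdxA p q r) : 0 ≤ famWA p q r d a := by
  rcases a with jk | i <;> simp only [famWA, Sum.elim_inl, Sum.elim_inr] <;> positivity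

/-- The `B`-weights are nonnegative (`d ≥ 0`). [folklore] -/
theorem famWB_nonneg (hd : 0 ≤ d) (b : IdxB p q r) : 0 ≤ famWB p q r d b := by
  rcases b with ik | j <;> simp only [famWB, Sum.elim_inl, Sum.elim_inr] <;> positivity

/-- The `C`-weights are nonnegative (`d ≥ 0`). [folklore] -/
theorem famWC_nonneg (hd : 0 ≤ d) (c : IdxC p q r) : 0 ≤ famWC p q r d c := by
  rcases c with ij | k <;> simp only [famWC, Sum.elim_inl, Sum.elim_inr] <;> positivity

/-- Total `A`-mass `qr · d/((p²+d)qr) + p · p/(p²+d) = 1` (`q, r ≥ 1`, `d > 0`). [folklore] -/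
theorem sum_famWA (hq : 1 ≤ q) (hr : 1 ≤ r) (hd : 0 < d) : ∑ a, famWA p q r d a = 1 := by
  have hq0 : (q : ℝ) ≠ 0 := by exact_mod_cast (show q ≠ 0 by omega)
  have hr0 : (r : ℝ) ≠ 0 := by exact_mod_cast (show r ≠ 0 by omega)
  have hpd : (p : ℝ) ^ 2 + d ≠ 0 := by positivity
  simp only [famWA, Fintype.sum_sum_type, Sum.elim_inl, Sum.elim_inr, Finset.sum_const,
    Finset.card_univ, Fintype.card_prod, Fintype.card_fin, nsmul_eq_mul]
  push_cast
  field_simp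
  ring

/-- Total `B`-mass `pr · d/((q²+d)pr) + q · q/(q²+d) = 1` (`p, r ≥ 1`, `d > 0`). [folklore] -/
theorem sum_famWB (hp : 1 ≤ p) (hr : 1 ≤ r) (hd : 0 < d) : ∑ b, famWB p q r d b = 1 := by
  have hp0 : (p : ℝ) ≠ 0 := by exact_mod_cast (show p ≠ 0 by omega)
  have hr0 : (r : ℝ) ≠ 0 := by exact_mod_cast (show r ≠ 0 by omega)
  have hqd : (q : ℝ) ^ 2 + d ≠ 0 := by positivity
  simp only [famWB, Fintype.sum_sum_type, Sum.elim_inl, Sum.elim_inr, Finset.sum_const,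
    Finset.card_univ, Fintype.card_prod, Fintype.card_fin, nsmul_eq_mul]
  push_cast
  field_simp
  ring

/-- Total `C`-mass `pq · d/((r²+d)pq) + r · r/(r²+d) = 1` (`p, q ≥ 1`, `d > 0`). [folklore] -/
theorem sum_famWC (hp : 1 ≤ p) (hq : 1 ≤ q) (hd : 0 < d) : ∑ c, famWC p q r d c = 1 := by
  have hp0 : (p : ℝ) ≠ 0 := by exact_mod_cast (show p ≠ 0 by omega)
  have hq0 : (q : ℝ) ≠ 0 := by exact_mod_cast (show q ≠ 0 by omega)
  have hrd : (r : ℝ) ^ 2 + d ≠ 0 := by positivity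
  simp only [famWC, Fintype.sum_sum_type, Sum.elim_inl, Sum.elim_inr, Finset.sum_const,
    Finset.card_univ, Fintype.card_prod, Fintype.card_fin, nsmul_eq_mul]
  push_cast
  field_simp
  ring

/-- `E_d > 1` (`p, q, r ≥ 1`, `d > 0`): `(p²+d)(q²+d)(r²+d) > d`. [folklore] -/
theorem one_lt_famE (hp : 1 ≤ p) (hq : 1 ≤ q) (hr : 1 ≤ r) (hd : 0 < d) : 1 < famE p q r d := by
  have hp1 : (1 : ℝ) ≤ p := by exact_mod_cast hp
  have hq1 : (1 : ℝ) ≤ q := by exact_mod_cast hq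
  have hr1 : (1 : ℝ) ≤ r := by exact_mod_cast hr
  have hp2 : (1 : ℝ) ≤ (p : ℝ) ^ 2 := by nlinarith
  have hq2 : (1 : ℝ) ≤ (q : ℝ) ^ 2 + d := by nlinarith
  have hr2 : (1 : ℝ) ≤ (r : ℝ) ^ 2 + d := by nlinarith
  unfold famE
  rw [lt_div_iff₀ hd]
  have h1 : d < (p : ℝ) ^ 2 + d := by linarith
  have h2 : (p : ℝ) ^ 2 + d ≤ ((p : ℝ) ^ 2 + d) * ((q : ℝ) ^ 2 + d) :=
    le_mul_of_one_le_right (by positivity) hq2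
  have h3 : ((p : ℝ) ^ 2 + d) * ((q : ℝ) ^ 2 + d) ≤
      ((p : ℝ) ^ 2 + d) * ((q : ℝ) ^ 2 + d) * ((r : ℝ) ^ 2 + d) :=
    le_mul_of_one_le_right (by positivity) hr2
  linarith

/-- `E_d > 0`. [folklore] -/
theorem famE_pos (hp : 1 ≤ p) (hq : 1 ≤ q) (hr : 1 ≤ r) (hd : 0 < d) : 0 < famE p q r d :=
  zero_lt_one.trans (one_lt_famE hp hq hr hd)

/-- `θ_d = E_d^{-1/3}`, so that `1/θ_d = E_d^{1/3}` is the certified upper bound for `Q̃(T_{p,q,r})`.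
[cite: ChristandlVranaZuiddam2021, §4.2] -/
noncomputable def famTheta (p q r : ℕ) (d : ℝ) : ℝ := (1 / famE p q r d) ^ ((3 : ℝ)⁻¹)

/-- `θ_d > 0`. [folklore] -/
theorem famTheta_pos (hp : 1 ≤ p) (hq : 1 ≤ q) (hr : 1 ≤ r) (hd : 0 < d) : 0 < famTheta p q r d :=
  Real.rpow_pos_of_pos (by have := famE_pos hp hq hr hd; positivity) _

/-- `θ_d³ = 1/E_d`. [folklore] -/
theorem famTheta_pow_three (hp : 1 ≤ p) (hq : 1 ≤ q) (hr : 1 ≤ r) (hd : 0 < d) :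
    famTheta p q r d ^ 3 = 1 / famE p q r d := by
  unfold famTheta
  have hE := famE_pos hp hq hr hd
  have h := Real.rpow_inv_natCast_pow (x := 1 / famE p q r d) (n := 3) (by positivity) (by norm_num)
  push_cast at h
  exact h

/-- `θ_d < 1` (`E_d > 1`). [folklore] -/
theorem famTheta_lt_one (hp : 1 ≤ p) (hq : 1 ≤ q) (hr : 1 ≤ r) (hd : 0 < d) : famTheta p q r d < 1 := by
  have hE := one_lt_famE hp hq hr hd
  unfold famTheta
  refine Real.rpow_lt_one (by positivity) ?_ (by norm_num)
  rw [div_lt_one (by linarith)]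
  exact hE

/-- `log₂(1/θ_d) = (1/3) log₂ E_d`. [folklore] -/
theorem logb_inv_famTheta (hp : 1 ≤ p) (hq : 1 ≤ q) (hr : 1 ≤ r) (hd : 0 < d) :
    Real.logb 2 (1 / famTheta p q r d) = Real.logb 2 (famE p q r d) / 3 := by
  have hE := famE_pos hp hq hr hd
  rw [one_div, Real.logb_inv, famTheta, Real.logb_rpow_eq_mul_logb_of_pos (by positivity),
    one_div, Real.logb_inv]
  ring

/-- **The certificate covers the support with equality**: at every support point of `T_{p,q,r}` the
weight product is exactly `d/((p²+d)(q²+d)(r²+d)) = θ_d³` (`p, q, r ≥ 1`, `d > 0`).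
[cite: KassabovEtAl2026, Ex. 2.2] -/
theorem famWeight_supp (hp : 1 ≤ p) (hq : 1 ≤ q) (hr : 1 ≤ r) (hd : 0 < d) :
    ∀ a b c, bigcen K p q r a b c ≠ 0 →
      famTheta p q r d ^ 3 ≤ famWA p q r d a * famWB p q r d b * famWC p q r d c := by
  have hp0 : (p : ℝ) ≠ 0 := by exact_mod_cast (show p ≠ 0 by omega)
  have hq0 : (q : ℝ) ≠ 0 := by exact_mod_cast (show q ≠ 0 by omega)
  have hr0 : (r : ℝ) ≠ 0 := by exact_mod_cast (show r ≠ 0 by omega)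
  have hd0 : d ≠ 0 := hd.ne'
  have hpd : (p : ℝ) ^ 2 + d ≠ 0 := by positivity
  have hqd : (q : ℝ) ^ 2 + d ≠ 0 := by positivity
  have hrd : (r : ℝ) ^ 2 + d ≠ 0 := by positivity
  intro a b c h
  rw [famTheta_pow_three hp hq hr hd]
  rcases a with jk | i <;> rcases b with ik | j <;> rcases c with ij | k <;>
    simp only [bigcen_ll, bigcen_lrl, bigcen_rll, bigcen_rrr, ne_eq, not_true_eq_false] at h <;>
    simp only [famWA, famWB, famWC, famE, Sum.elim_inl, Sum.elim_inr] <;> apply le_of_eq <;>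
    field_simp

/-- **`T_{p,q,r} ≥ ⟨2⟩` when `r ≥ 2`**: zero out to `a ∈ {a_{00}, a_0}`, `b ∈ {b_0, b_{01}}`,
`c ∈ {c_0, c_1}` (support points `(a_{00}, b_0, c_0)` and `(a_0, b_{01}, c_1)`). [folklore] -/
theorem tensorRestrictsTo_bigcen_unitTensor_two_of_r (hp : 1 ≤ p) (hq : 1 ≤ q) (hr : 2 ≤ r) :
    TensorRestrictsTo (kroneckerPow (bigcen K p q r) 1) (unitTensor K 2) := by
  set i₀ : Fin p := ⟨0, hp⟩ with hi₀
  set j₀ : Fin q := ⟨0, hq⟩ with hj₀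
  set k₀ : Fin r := ⟨0, by omega⟩ with hk₀
  set k₁ : Fin r := ⟨1, by omega⟩ with hk₁
  set fA : Fin 2 → IdxA p q r := ![Sum.inl (j₀, k₀), Sum.inr i₀] with hfA
  set fB : Fin 2 → IdxB p q r := ![Sum.inr j₀, Sum.inl (i₀, k₁)] with hfB
  set fC : Fin 2 → IdxC p q r := ![Sum.inr k₀, Sum.inr k₁] with hfC
  have key : unitTensor K 2 = fun x y z => kroneckerPow (bigcen K p q r) 1
      (fun _ => fA x) (fun _ => fB y) (fun _ => fC z) := by
    funext x y z
    fin_cases x <;> fin_cases y <;> fin_cases z <;>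
      simp [kroneckerPow_apply, hfA, hfB, hfC, hk₀, hk₁, Fin.ext_iff]
  rw [key]
  exact tensorRestrictsTo_precomp _ _ _ _

/-- **`T_{p,q,r} ≥ ⟨2⟩` when `q ≥ 2`**: zero out to `a ∈ {a_{00}, a_0}`, `b ∈ {b_0, b_1}`,
`c ∈ {c_0, c_{01}}` (support points `(a_{00}, b_0, c_0)` and `(a_0, b_1, c_{01})`). [folklore] -/
theorem tensorRestrictsTo_bigcen_unitTensor_two_of_q (hp : 1 ≤ p) (hq : 2 ≤ q) (hr : 1 ≤ r) :
    TensorRestrictsTo (kroneckerPow (bigcen K p q r) 1) (unitTensor K 2) := by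
  set i₀ : Fin p := ⟨0, hp⟩ with hi₀
  set j₀ : Fin q := ⟨0, by omega⟩ with hj₀
  set j₁ : Fin q := ⟨1, by omega⟩ with hj₁
  set k₀ : Fin r := ⟨0, hr⟩ with hk₀
  set fA : Fin 2 → IdxA p q r := ![Sum.inl (j₀, k₀), Sum.inr i₀] with hfA
  set fB : Fin 2 → IdxB p q r := ![Sum.inr j₀, Sum.inr j₁] with hfB
  set fC : Fin 2 → IdxC p q r := ![Sum.inr k₀, Sum.inl (i₀, j₁)] with hfC
  have key : unitTensor K 2 = fun x y z => kroneckerPow (bigcen K p q r) 1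
      (fun _ => fA x) (fun _ => fB y) (fun _ => fC z) := by
    funext x y z
    fin_cases x <;> fin_cases y <;> fin_cases z <;>
      simp [kroneckerPow_apply, hfA, hfB, hfC, hj₀, hj₁, Fin.ext_iff]
  rw [key]
  exact tensorRestrictsTo_precomp _ _ _ _

/-- **`T_{p,q,r} ≥ ⟨2⟩` whenever `qr ≥ 2`** (`p, q, r ≥ 1`). [folklore] -/
theorem tensorRestrictsTo_bigcen_unitTensor_two (hp : 1 ≤ p) (hq : 1 ≤ q) (hr : 1 ≤ r)
    (h2 : 2 ≤ q * r) : TensorRestrictsTo (kroneckerPow (bigcen K p q r) 1) (unitTensor K 2) := by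
  rcases Nat.lt_or_ge r 2 with hr2 | hr2
  · have hr1 : r = 1 := by omega
    subst hr1
    exact tensorRestrictsTo_bigcen_unitTensor_two_of_q hp (by simpa using h2) hr
  · exact tensorRestrictsTo_bigcen_unitTensor_two_of_r hp hq hr2

/-- `log₂ E_d > 0`. [folklore] -/
theorem logb_famE_pos (hp : 1 ≤ p) (hq : 1 ≤ q) (hr : 1 ≤ r) (hd : 0 < d) :
    0 < Real.logb 2 (famE p q r d) :=
  Real.logb_pos one_lt_two (one_lt_famE hp hq hr hd)

/-- **`ω(T_{p,q,r}, ⟨2⟩) ≥ 3 / log₂ E_d`**, i.e. `Q̃(T_{p,q,r}) ≤ ((p²+d)(q²+d)(r²+d)/d)^{1/3}` for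
every `d > 0` (`p, q, r ≥ 1`, `qr ≥ 2`; CVZ §4.2 with the certificate `famWA/B/C d`).
[cite: ChristandlVranaZuiddam2021, §4.2] -/
theorem three_div_le_relativeExponent_bigcen_unit (hp : 1 ≤ p) (hq : 1 ≤ q) (hr : 1 ≤ r)
    (h2 : 2 ≤ q * r) (hd : 0 < d) :
    3 / Real.logb 2 (famE p q r d) ≤ relativeExponent (bigcen K p q r) (unitTensor K 2) := by
  have h := inv_logb_le_relativeExponent_of_weights (bigcen K p q r) (famWA p q r d)
    (famWB p q r d) (famWC p q r d) (famWA_nonneg hd.le) (famWB_nonneg hd.le) (famWC_nonneg hd.le)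
    (sum_famWA hq hr hd).le (sum_famWB hp hr hd).le (sum_famWC hp hq hd).le
    (famTheta_pos hp hq hr hd) (famTheta_lt_one hp hq hr hd) (famWeight_supp (K := K) hp hq hr hd)
    (tensorRestrictsTo_bigcen_unitTensor_two hp hq hr h2)
  rw [logb_inv_famTheta hp hq hr hd, one_div_div] at h
  exact h

end BigCentroidFamily

end Summit.MatrixMultiplication.MatrixMultiplication.Theorems
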